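import Mathlib

/-!
# Crux `NikulinSerreCarrier` · line `neron-severi-intertwiner` · stub `stub_blockSumNoGo` (S3 §F3) —
# block sums with vanishing column sums never hit a non-zero multiple of an independent frame

Helper file (`--supports stmt-HodgeConjecture-14464`) for the stub `stub_blockSumNoGo` of the
skeleton `Cruxes/NikulinSerreCarrier/Lines/neron-severi-intertwiner.lean`: the linear-algebra core
of the negative design constraint §F3 of the lead's S3 notes. Every carrier candidate of the shape
"direct sum of Γ-blocks twisted by line bundles" has Néron–Severi block
`κ_*(N_l) = Σ_j Λ_{jl} · c_j` for a square coefficient matrix `Λ` with ZERO COLUMN SUMS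
(`Σ_j Λ_{jl} = 0`), whereas the target asks for `κ_*(N_l) = m · r_l` with `r_1, …, r_n` linearly
independent. This forces `m = 0`.

Proof (pure linear algebra over any field, in fact any integral domain for the determinant step):
the all-ones row vector lies in the left kernel of `Λ`, so `det Λ = 0` (`0 < n` makes the all-ones
vector non-zero), so some `a ≠ 0` lies in the right kernel, `Λ a = 0`. Then
`Σ_l (a_l m) · r_l = Σ_l a_l · Σ_j Λ_{jl} · c_j = Σ_j (Λ a)_j · c_j = 0`, and linear independence of
`r` gives `a_l m = 0` for all `l`; some `a_l ≠ 0`, hence `m = 0`.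

* `det_eq_zero_of_colSum_eq_zero`, `exists_mulVec_eq_zero_of_colSum_eq_zero` — the singular matrix;
* `sum_smul_sum_smul_eq_sum_mulVec_smul` — the re-bracketing
  `Σ_l a_l • Σ_j Λ_{jl} • c_j = Σ_j (Λ a)_j • c_j`;
* `stub_blockSumNoGo` — the registered stub, verbatim.
No geometry here. [folklore]
-/

-- the doubled component `HodgeConjecture.HodgeConjecture` is the summit/problem layout (D-0022),
-- not a slip
set_option linter.dupNamespace false

namespace Summit.HodgeConjecture.HodgeConjecture.Theorems.NikulinSerreCarrier.NeronSeveriIntertwiner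

open scoped BigOperators Matrix

/-- A square matrix of positive size over an integral domain all of whose column sums vanish is
singular: the all-ones row vector is a non-zero element of its left kernel. [folklore] -/
theorem det_eq_zero_of_colSum_eq_zero {K : Type*} [CommRing K] [IsDomain K] {n : ℕ}
    (Λ : Matrix (Fin n) (Fin n) K) (hΛ : ∀ l, ∑ j, Λ j l = 0) (hn : 0 < n) : Λ.det = 0 := by
  refine Matrix.exists_vecMul_eq_zero_iff.mp ⟨1, ?_, ?_⟩
  · intro h
    have h0 := congr_fun h ⟨0, hn⟩
    simp only [Pi.one_apply, Pi.zero_apply] at h0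
    exact one_ne_zero h0
  · funext l
    simp only [Matrix.vecMul, one_dotProduct, Pi.zero_apply]
    exact hΛ l

/-- A square matrix of positive size over an integral domain all of whose column sums vanish has a
non-zero vector in its right kernel. [folklore] -/
theorem exists_mulVec_eq_zero_of_colSum_eq_zero {K : Type*} [CommRing K] [IsDomain K] {n : ℕ}
    (Λ : Matrix (Fin n) (Fin n) K) (hΛ : ∀ l, ∑ j, Λ j l = 0) (hn : 0 < n) :
    ∃ a : Fin n → K, a ≠ 0 ∧ Λ *ᵥ a = 0 :=
  Matrix.exists_mulVec_eq_zero_iff.mpr (det_eq_zero_of_colSum_eq_zero Λ hΛ hn)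

/-- Re-bracketing a double linear combination through a coefficient matrix:
`Σ_l a_l • (Σ_j Λ_{jl} • c_j) = Σ_j (Λ a)_j • c_j`. [folklore] -/
theorem sum_smul_sum_smul_eq_sum_mulVec_smul {K V : Type*} [CommRing K] [AddCommGroup V]
    [Module K V] {n : ℕ} (Λ : Matrix (Fin n) (Fin n) K) (c : Fin n → V) (a : Fin n → K) :
    ∑ l, a l • ∑ j, Λ j l • c j = ∑ j, (Λ *ᵥ a) j • c j := by
  simp_rw [Finset.smul_sum, smul_smul, Matrix.mulVec, dotProduct, Finset.sum_smul]
  rw [Finset.sum_comm]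
  refine Finset.sum_congr rfl fun j _ ↦ Finset.sum_congr rfl fun l _ ↦ ?_
  rw [mul_comm]

/-- **Block sums with zero column sums: the no-go (§F3).** Over a field `K`, if a square matrix `Λ`
of positive size `n` has all column sums zero, `r_1, …, r_n` are linearly independent, and
`Σ_j Λ_{jl} • c_j = m • r_l` for every `l`, then `m = 0`: the `n` block sums lie in the image of the
hyperplane `{a | Σ a_j = 0}` (dimension `≤ n − 1`), so they cannot be a non-zero multiple of an
independent `n`-frame. This is the registered stub `stub_blockSumNoGo` of the skeleton, verbatim.
[folklore] -/
theorem stub_blockSumNoGo : ∀ {K V : Type} [Field K] [AddCommGroup V] [Module K V] {n : ℕ}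
    (Λ : Matrix (Fin n) (Fin n) K) (c r : Fin n → V) (m : K), (∀ l, ∑ j, Λ j l = 0) →
    LinearIndependent K r → (∀ l, ∑ j, Λ j l • c j = m • r l) → 0 < n → m = 0 := by
  intro K V _ _ _ n Λ c r m hΛ hr hc hn
  obtain ⟨a, ha, hΛa⟩ := exists_mulVec_eq_zero_of_colSum_eq_zero Λ hΛ hn
  obtain ⟨l, hl⟩ := Function.ne_iff.mp ha
  have hsum : ∑ l, (a l * m) • r l = 0 := by
    simp_rw [mul_smul, ← hc]
    rw [sum_smul_sum_smul_eq_sum_mulVec_smul, hΛa]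
    exact Finset.sum_eq_zero fun j _ ↦ by rw [Pi.zero_apply, zero_smul]
  have hlm : a l * m = 0 := Fintype.linearIndependent_iff.mp hr (fun l ↦ a l * m) hsum l
  exact (mul_eq_zero.mp hlm).resolve_left hl

end Summit.HodgeConjecture.HodgeConjecture.Theorems.NikulinSerreCarrier.NeronSeveriIntertwiner
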